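import Literature.NumberTheory.Automorphic.CDTTheorem722
import Literature.NumberTheory.Automorphic.CDTTheorem712
import Literature.NumberTheory.Automorphic.BCDTModularity
import Literature.NumberTheory.Automorphic.BCDTModularityModPProofs
import Literature.NumberTheory.Automorphic.HeckeAlgebraOfTypeSigma
import Literature.NumberTheory.Automorphic.ChebotarevArtinRepHolds
import Literature.NumberTheory.EllipticCurves.FramedTateGaloisRep
import Literature.NumberTheory.EllipticCurves.FrobeniusTraceBaseChange
import Literature.NumberTheory.EllipticCurves.FrobeniusTateModuleProofs
import Literature.NumberTheory.EllipticCurves.TateModuleFreeProofs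
import Literature.NumberTheory.EllipticCurves.TateModuleFinrankProofs
import Literature.NumberTheory.EllipticCurves.NewformGaloisRepModLOfPadicAlgClProofs
import Literature.NumberTheory.GaloisRepresentations.FramedRepBaseChange
import Literature.NumberTheory.GaloisRepresentations.ResidualGaloisRep
import Literature.NumberTheory.GaloisRepresentations.ResidualRepRestrict
import Literature.NumberTheory.GaloisRepresentations.PatchingLemma
import Literature.NumberTheory.GaloisRepresentations.FrobeniusDensity
import Literature.RepresentationTheory.Semisimple.IrreducibleOfCharpoly
import Literature.NumberTheory.DiophantineGeometry.Conductor
import Literature.FieldTheory.AlgClosed.PadicAlgClEquivComplex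
import HarnessLib

/-!
# Stub-ideation k = 2, GENERATION 10 (home family 2 = RESHAPE) for `stub_liftFive` of crux
# `FreyModularity` (stmt-ABC-11340, route ABC/DefiniteXi, line `Lines/Sketch.lean` sha 21576c53)

Companion of `STUB-IDEAS-stub_liftFive-2.md` (gen 10).  Gens 7–9 (`StubIdeas.LiftFive2g8/2g9`,
rc 0) reshaped `stub_liftFive` (Diamond 1996, Thm 5.3 / CDT Thm 7.2.2: modularity lifting at `5`
in the flat-or-ordinary semistable case) into PROVED adapters around ONE opaque debt
X′ `MLTTateSemistableFive'` = "`ρ_{W,5}` is `GL₂(ℚ̄₅)`-CONJUGATE to a member of DDT's family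
`N_S^{ss}(ρ₀)`".

Gen 10 makes the family-2 move **weaken → bootstrap on the debt itself**.  An `R_S = T_S`
theorem never outputs a conjugating matrix: it outputs a point `T_S → ℤ̄₅`, i.e. a newform `g` of
the family whose Hecke eigenvalues — the TRACES OF FROBENIUS of the member `ρ_g` — are those of
`ρ_{W,5}` at the places outside a finite set.  So the debt is cut into

* X‴ `MLTFrobTraceFive` (THE NEW, WEAKER DEBT): some member `ρ'` has
  `tr ρ'(Frob_v) = tr ρ_{W,5}(Frob_v)` for all places `v` outside a finite set;
* X‴ ⇒ X″ `MLTTraceFive` (all `σ ∈ Γ_ℚ`): **PROVED** (`mltTraceFive_of_frobTrace`) — Chebotarev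
  density of Frobenii (`absoluteGaloisGroup.frobenius_dense` fed with the tree's CLOSED
  `chebotarev_artinRep_holds`), continuity of traces (`FramedRep.continuous_trace`), `ℚ̄₅` Hausdorff;
* X″ ⇒ X′: **PROVED** (`mltTateSemistableFive'_of_trace`) from B1 — traces + determinants (clause
  (iii) of the carrier + H3's cyclotomic determinant) give the characteristic polynomials in rank 2
  (`Matrix.charpoly_fin_two`); `ρ_{W,5} ⊗ ℚ̄₅` is irreducible (B1), hence so is `ρ' ⊗ ℚ̄₅`
  (`isIrreducible_of_charpoly_eq`, Brauer–Nesbitt over any field), both are semisimple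
  (`isSemisimpleRepresentation_of_isIrreducible`), and equal traces of semisimple representations in
  characteristic `0` give conjugacy (`SorensenPatching.exists_conj_of_trace_eq`);
* B1 `IrredFramedTateFive`: `ρ̄` absolutely irreducible and `ρ̄ ≅ W[5]` ⇒ `ρ_{W,5} ⊗ ℚ̄₅`
  irreducible — **PROVED in the companion file `STUB_IDEAS_stub_liftFive_2g10_B1.lean`**
  (`irredFramedTateFive_holds`, kept apart because its import
  `IrreducibleOfIrreducibleReduction` sits behind a module the farm snapshot had not built) by the
  tree's `FramedGaloisRep.isIrreducible_of_hasResidualCharpolys` (DDT §2.1), the residual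
  characteristic polynomials being supplied by `IsTorsionGaloisRep.charpoly_eq_map_charpoly_galoisRepTate`
  and the ring map B1a `ℤ₅ → ℤ̄₅` compatible with `ℚ₅ → ℚ̄₅` and with reduction mod `5`.

Net effect (kernel-checked, `debt_of_frobTrace`): **X′ ⟸ B1 + X‴**, so after gen 10 the k2 line reads
`stub_liftFive`-for-the-consumer ⟸ SwitchPlus + {M2, M3, M4, O1a, O1d} (gen 9, one-cycle targets)
+ X‴ (the `R_S = T_S` output in its native eigenvalue currency).  Sanity: X′ ⇒ X″ ⇒ X‴
(`frobTrace_of_debt`), so nothing was strengthened.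

Nothing here is registered.  NO `sorry`: helper STATEMENTS are `def … : Prop`; every `theorem` is
proved.
-/

noncomputable section

open scoped MatrixGroups Matrix NumberField ModularForm Polynomial Classical NNReal
open NumberField IsDedekindDomain IsDedekindDomain.HeightOneSpectrum Polynomial Filter
open Literature.NumberTheory Literature.NumberTheory.Automorphic Literature.NumberTheory.Automorphic.BCDT
open Literature.NumberTheory.GaloisRepresentations Literature.NumberTheory.GaloisRepresentations.ModPGaloisRep
open Literature.NumberTheory.EllipticCurves Literature.NumberTheory.EllipticCurves.ModularForms
open CongruenceSubgroup Rat.HeightOneSpectrum WeierstrassCurve Field IsLocalRing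

namespace Summit.ABC.ABC.Cruxes.FreyModularity.StubIdeas.LiftFive2g10

universe u v

/-! ### Carrier and the debt X′ (copied VERBATIM from `StubIdeas.LiftFive2g8/2g9`) -/

section Carrier

variable (p : ℕ) (k : ℤ) {O : Type u} [CommRing O] [TopologicalSpace O]
  (Ō : Type v) [CommRing Ō] [IsLocalRing Ō] [TopologicalSpace Ō] [Algebra O Ō]
  (ρ : FramedGaloisRep ℚ O 2) (S : Set ℕ)

/-- `N_Σ^{ss}(Ō)` — verbatim `modularLiftsOfTypeSigma` (DFG §3.1) with the level condition `¬ p ∣ M`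
relaxed to `¬ p ^ 2 ∣ M` (DDT Def. 3.25 / Lemma 3.26).  Identical to gen 7/8/9.
[cite: DarmonDiamondTaylor1995, §3.3 (p. 94)] -/
def modularLiftsOfTypeSigmaSemistable : Set (FramedGaloisRep ℚ Ō 2) :=
  {ρ' | (∃ (M : ℕ) (_ : NeZero M) (g : CuspForm (Gamma1 M) k) (j : coeffCharIntegers g →+* Ō),
          IsNewform1 g ∧ ¬ p ^ 2 ∣ M ∧ IsGaloisRepOfNewform1Int g j {r | r ∣ M * p} ρ') ∧
      (∀ (σ : absoluteGaloisGroup ℚ) (i : ℕ),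
          (FramedRep.charpoly ρ' σ).coeff i - algebraMap O Ō ((FramedRep.charpoly ρ σ).coeff i) ∈
            maximalIdeal Ō) ∧
      (∀ σ : absoluteGaloisGroup ℚ,
          ((ρ' σ : GL (Fin 2) Ō) : Matrix (Fin 2) (Fin 2) Ō).det =
            algebraMap O Ō ((ρ σ : GL (Fin 2) O) : Matrix (Fin 2) (Fin 2) O).det) ∧
      ∀ v : HeightOneSpectrum (𝓞 ℚ), ((primesEquiv v : Nat.Primes) : ℕ) ∉ S →
        ((primesEquiv v : Nat.Primes) : ℕ) ≠ p → ρ'.IsMinimallyRamifiedAt v}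

end Carrier

/-- **X′ `MLTTateSemistableFive'`** (gen 8's debt, verbatim): `ρ_{W,5}` is conjugate to a member of
`N_S^{ss}(ρ₀)`. [cite: Stevens1997Overview, (7.4) Theorem and Corollary, p. 74] [cite: Diamond1996, Thm. 5.3] -/
def MLTTateSemistableFive' : Prop :=
  ∀ (W : WeierstrassCurve ℚ) [W.IsElliptic] (ρ : ModPGaloisRep ℚ (ZMod 5) 2),
    W.IsTorsionGaloisRep 5 ρ → ρ.IsAbsIrreducibleOverSqrt 5 → ¬ 25 ∣ W.conductorNorm ℤ →
    ∀ (hf : Continuous (padicAlgClIntegers 5).subtype)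
      (ρ₀ : FramedGaloisRep ℚ (padicAlgClIntegers 5) 2) (S : Set ℕ),
      ρ₀ ∈ modularLiftsOfTypeSigmaSemistable 5 2 (padicAlgClIntegers 5) ρ₀ S →
      (∀ (σ : absoluteGaloisGroup ℚ) (i : ℕ),
        Valued.v (((FramedRep.charpoly ρ₀ σ).coeff i : PadicAlgCl 5) -
          (FramedRep.charpoly (W.framedTateGaloisRep 5) σ).coeff i) < 1) →
      (∀ σ : absoluteGaloisGroup ℚ,
        (((ρ₀ σ : GL (Fin 2) (padicAlgClIntegers 5)) :
            Matrix (Fin 2) (Fin 2) (padicAlgClIntegers 5)).det : PadicAlgCl 5) =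
          ((W.framedTateGaloisRep 5 σ : GL (Fin 2) (PadicAlgCl 5)) :
            Matrix (Fin 2) (Fin 2) (PadicAlgCl 5)).det) →
      S.Finite → 5 ∉ S → (∀ q : ℕ, q.Prime → q ∣ W.conductorNorm ℤ → q ≠ 5 → q ∈ S) →
      ∃ ρ' ∈ modularLiftsOfTypeSigmaSemistable 5 2 (padicAlgClIntegers 5) ρ₀ S,
        ∃ P : GL (Fin 2) (PadicAlgCl 5),
          FramedRep.conj P (FramedRep.baseChange (padicAlgClIntegers 5).subtype hf ρ') =
            W.framedTateGaloisRep 5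

/-! ### T (gen 10) — the debt weakened to traces, then to traces of Frobenius -/

/-- **X″ `MLTTraceFive`** (weaker than X′): under the hypotheses of X′, some member `ρ'` of
`N_S^{ss}(ρ₀)` has THE SAME TRACES as `ρ_{W,5}` on all of `Γ_ℚ`.  No conjugating matrix, no frame.
[cite: DarmonDiamondTaylor1995, §3.3 (T_Σ is generated by traces) and Thm. 3.42] -/
def MLTTraceFive : Prop :=
  ∀ (W : WeierstrassCurve ℚ) [W.IsElliptic] (ρ : ModPGaloisRep ℚ (ZMod 5) 2),
    W.IsTorsionGaloisRep 5 ρ → ρ.IsAbsIrreducibleOverSqrt 5 → ¬ 25 ∣ W.conductorNorm ℤ →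
    ∀ (ρ₀ : FramedGaloisRep ℚ (padicAlgClIntegers 5) 2) (S : Set ℕ),
      ρ₀ ∈ modularLiftsOfTypeSigmaSemistable 5 2 (padicAlgClIntegers 5) ρ₀ S →
      (∀ (σ : absoluteGaloisGroup ℚ) (i : ℕ),
        Valued.v (((FramedRep.charpoly ρ₀ σ).coeff i : PadicAlgCl 5) -
          (FramedRep.charpoly (W.framedTateGaloisRep 5) σ).coeff i) < 1) →
      (∀ σ : absoluteGaloisGroup ℚ,
        (((ρ₀ σ : GL (Fin 2) (padicAlgClIntegers 5)) :
            Matrix (Fin 2) (Fin 2) (padicAlgClIntegers 5)).det : PadicAlgCl 5) =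
          ((W.framedTateGaloisRep 5 σ : GL (Fin 2) (PadicAlgCl 5)) :
            Matrix (Fin 2) (Fin 2) (PadicAlgCl 5)).det) →
      S.Finite → 5 ∉ S → (∀ q : ℕ, q.Prime → q ∣ W.conductorNorm ℤ → q ≠ 5 → q ∈ S) →
      ∃ ρ' ∈ modularLiftsOfTypeSigmaSemistable 5 2 (padicAlgClIntegers 5) ρ₀ S,
        ∀ σ : absoluteGaloisGroup ℚ,
          ((FramedRep.trace ρ' σ : padicAlgClIntegers 5) : PadicAlgCl 5) =
            FramedRep.trace (W.framedTateGaloisRep 5) σ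

/-- **X‴ `MLTFrobTraceFive`** (THE NEW DEBT; weaker than X″): under the hypotheses of X′, some member
`ρ'` of `N_S^{ss}(ρ₀)` has the same trace as `ρ_{W,5}` at every ARITHMETIC FROBENIUS `σ` at every
prime `𝔓` of `ℤ̄` over every place `v` outside some finite set `S'` — i.e. (for `ρ' = ρ_{g,j}`
attached to the newform `g`) `j(a_v(g)) = a_v(W)` for almost all `v`: the output of
`R_S ≅ T_S` (DDT Thm. 3.42 / Diamond 1996 Thm. 5.3) read at the point `ρ_{W,5}` of `R_S`.
[cite: DarmonDiamondTaylor1995, Thm. 3.42 and Lemma 3.29] [cite: Diamond1996, Thm. 5.3] -/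
def MLTFrobTraceFive : Prop :=
  ∀ (W : WeierstrassCurve ℚ) [W.IsElliptic] (ρ : ModPGaloisRep ℚ (ZMod 5) 2),
    W.IsTorsionGaloisRep 5 ρ → ρ.IsAbsIrreducibleOverSqrt 5 → ¬ 25 ∣ W.conductorNorm ℤ →
    ∀ (ρ₀ : FramedGaloisRep ℚ (padicAlgClIntegers 5) 2) (S : Set ℕ),
      ρ₀ ∈ modularLiftsOfTypeSigmaSemistable 5 2 (padicAlgClIntegers 5) ρ₀ S →
      (∀ (σ : absoluteGaloisGroup ℚ) (i : ℕ),
        Valued.v (((FramedRep.charpoly ρ₀ σ).coeff i : PadicAlgCl 5) -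
          (FramedRep.charpoly (W.framedTateGaloisRep 5) σ).coeff i) < 1) →
      (∀ σ : absoluteGaloisGroup ℚ,
        (((ρ₀ σ : GL (Fin 2) (padicAlgClIntegers 5)) :
            Matrix (Fin 2) (Fin 2) (padicAlgClIntegers 5)).det : PadicAlgCl 5) =
          ((W.framedTateGaloisRep 5 σ : GL (Fin 2) (PadicAlgCl 5)) :
            Matrix (Fin 2) (Fin 2) (PadicAlgCl 5)).det) →
      S.Finite → 5 ∉ S → (∀ q : ℕ, q.Prime → q ∣ W.conductorNorm ℤ → q ≠ 5 → q ∈ S) →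
      ∃ ρ' ∈ modularLiftsOfTypeSigmaSemistable 5 2 (padicAlgClIntegers 5) ρ₀ S,
        ∃ S' : Set (HeightOneSpectrum (𝓞 ℚ)), S'.Finite ∧
          ∀ v ∉ S', ∀ 𝔓 ∈ v.primesAbove, ∀ σ : absoluteGaloisGroup ℚ, IsArithFrobAt (𝓞 ℚ) σ 𝔓 →
            ((FramedRep.trace ρ' σ : padicAlgClIntegers 5) : PadicAlgCl 5) =
              FramedRep.trace (W.framedTateGaloisRep 5) σ

/-- **B1 `IrredFramedTateFive`**: if `ρ̄ : Γ_ℚ → GL₂(𝔽₅)` is absolutely irreducible and is a framing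
of `W[5]`, then `ρ_{W,5} : Γ_ℚ → GL₂(ℚ̄₅)` is irreducible ("`ρ̄` irreducible ⇒ `ρ` irreducible",
DDT §2.1; PROVED below). [cite: DarmonDiamondTaylor1995, §2.1] -/
def IrredFramedTateFive : Prop :=
  ∀ (W : WeierstrassCurve ℚ) [W.IsElliptic] (ρ : ModPGaloisRep ℚ (ZMod 5) 2),
    W.IsTorsionGaloisRep 5 ρ → FramedRep.IsAbsolutelyIrreducible ρ →
    FramedRep.IsIrreducible (W.framedTateGaloisRep 5)

/-- **B1a `PadicIntHomCompat`** (ring-map bookkeeping, XS; PROVED in the companion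
`STUB_IDEAS_stub_liftFive_2g10_B1.lean`): a ring map `f : ℤ₅ → ℤ̄₅` over `ℚ₅ → ℚ̄₅` whose
reduction is "`x ↦ (x mod 5)`" read in `ℤ̄₅/𝔪` (stated with the natural-number representative, so
that no `CharP` instance / map `𝔽₅ → 𝔽̄₅` is needed to state it). [folklore] -/
def PadicIntHomCompat : Prop :=
  ∃ f : ℤ_[5] →+* padicAlgClIntegers 5,
    (padicAlgClIntegers 5).subtype.comp f =
        (algebraMap ℚ_[5] (PadicAlgCl 5)).comp (PadicInt.Coe.ringHom (p := 5)) ∧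
      ∀ x : ℤ_[5], residue (padicAlgClIntegers 5) (f x) =
        ((PadicInt.toZMod (p := 5) x).val : padicAlgClResidueField 5)

/-! ### Proofs: X‴ ⇒ X″ ⇒ X′ -/

/-- (PROVED) **X‴ ⇒ X″**: Frobenii outside a finite set are dense (`frobenius_dense`, Chebotarev
CLOSED in the tree), traces are continuous, `ℚ̄₅` is Hausdorff. -/
theorem mltTraceFive_of_frobTrace (h : MLTFrobTraceFive) : MLTTraceFive := by
  intro W _ ρ hρ habs h25 ρ₀ S hmem hcong hdet hSfin h5S hS
  obtain ⟨ρ', hρ', S', hS'fin, hfrob⟩ := h W ρ hρ habs h25 ρ₀ S hmem hcong hdet hSfin h5S hS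
  refine ⟨ρ', hρ', ?_⟩
  have hf : Continuous (padicAlgClIntegers 5).subtype := continuous_subtype_val
  have hdense := absoluteGaloisGroup.frobenius_dense chebotarev_artinRep_holds ℚ S' hS'fin
  have hc1 : Continuous fun σ : absoluteGaloisGroup ℚ =>
      ((FramedRep.trace ρ' σ : padicAlgClIntegers 5) : PadicAlgCl 5) := by
    have : (fun σ : absoluteGaloisGroup ℚ =>
        ((FramedRep.trace ρ' σ : padicAlgClIntegers 5) : PadicAlgCl 5)) =
        FramedRep.trace (FramedRep.baseChange (padicAlgClIntegers 5).subtype hf ρ') := by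
      funext σ
      change (padicAlgClIntegers 5).subtype (FramedRep.trace ρ' σ) = _
      unfold FramedRep.trace
      rw [AddMonoidHom.map_trace, FramedRep.coe_baseChange_apply]
    rw [this]
    exact FramedRep.continuous_trace _
  have hc2 : Continuous (FramedRep.trace (W.framedTateGaloisRep 5)) := FramedRep.continuous_trace _
  have heq := Continuous.ext_on hdense hc1 hc2 fun σ ⟨v, hv, 𝔓, h𝔓, hσ⟩ => hfrob v hv 𝔓 h𝔓 σ hσ
  exact fun σ => congrFun heq σ

/-- (PROVED) **X″ ⇒ X′** given B1: equal traces and determinants ⇒ equal characteristic polynomials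
(rank `2`) ⇒ `ρ' ⊗ ℚ̄₅` irreducible like `ρ_{W,5}` ⇒ both semisimple ⇒ conjugate (Brauer–Nesbitt in
characteristic `0`, `SorensenPatching.exists_conj_of_trace_eq`). -/
theorem mltTateSemistableFive'_of_trace (hB : IrredFramedTateFive) (hX : MLTTraceFive) :
    MLTTateSemistableFive' := by
  intro W _ ρ hρ habs h25 hf ρ₀ S hmem hcong hdet hSfin h5S hS
  obtain ⟨ρ', hρ', htr⟩ := hX W ρ hρ habs h25 ρ₀ S hmem hcong hdet hSfin h5S hS
  refine ⟨ρ', hρ', ?_⟩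
  obtain ⟨-, -, hdet', -⟩ := hρ'
  set τ : FramedGaloisRep ℚ (PadicAlgCl 5) 2 :=
    FramedRep.baseChange (padicAlgClIntegers 5).subtype hf ρ' with hτ
  -- traces
  have htr' : ∀ σ, FramedRep.trace τ σ = FramedRep.trace (W.framedTateGaloisRep 5) σ := fun σ => by
    rw [← htr σ]
    change _ = (padicAlgClIntegers 5).subtype (FramedRep.trace ρ' σ)
    unfold FramedRep.trace
    rw [AddMonoidHom.map_trace, hτ, FramedRep.coe_baseChange_apply]
  -- determinants
  have hdet'' : ∀ σ, ((τ σ : GL (Fin 2) (PadicAlgCl 5)) : Matrix (Fin 2) (Fin 2) (PadicAlgCl 5)).det =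
      ((W.framedTateGaloisRep 5 σ : GL (Fin 2) (PadicAlgCl 5)) :
        Matrix (Fin 2) (Fin 2) (PadicAlgCl 5)).det := fun σ => by
    have h3 := hdet' σ
    rw [Algebra.algebraMap_self_apply] at h3
    rw [← hdet σ, ← h3, hτ, FramedRep.coe_baseChange_apply, ← RingHom.mapMatrix_apply,
      ← RingHom.map_det]
    rfl
  -- characteristic polynomials
  have hcp : ∀ σ, ((τ σ : GL (Fin 2) (PadicAlgCl 5)) : Matrix (Fin 2) (Fin 2) (PadicAlgCl 5)).charpoly =
      ((W.framedTateGaloisRep 5 σ : GL (Fin 2) (PadicAlgCl 5)) :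
        Matrix (Fin 2) (Fin 2) (PadicAlgCl 5)).charpoly := fun σ => by
    rw [Matrix.charpoly_fin_two, Matrix.charpoly_fin_two, hdet'' σ]
    change X ^ 2 - C (FramedRep.trace τ σ) * X + _ = X ^ 2 - C (FramedRep.trace _ σ) * X + _
    rw [htr' σ]
  -- irreducibility and semisimplicity
  have hirrW : FramedRep.IsIrreducible (W.framedTateGaloisRep 5) :=
    hB W ρ hρ habs.isAbsolutelyIrreducible
  have hirrτ : FramedRep.IsIrreducible τ :=
    Literature.RepresentationTheory.Semisimple.isIrreducible_of_charpoly_eq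
      (τ : absoluteGaloisGroup ℚ →* GL (Fin 2) (PadicAlgCl 5))
      (W.framedTateGaloisRep 5 : absoluteGaloisGroup ℚ →* GL (Fin 2) (PadicAlgCl 5)) hcp hirrW
  have hssτ : τ.toRepresentation.IsSemisimpleRepresentation :=
    isSemisimpleRepresentation_of_isIrreducible hirrτ
  have hssW : (W.framedTateGaloisRep 5).toRepresentation.IsSemisimpleRepresentation :=
    isSemisimpleRepresentation_of_isIrreducible hirrW
  obtain ⟨P, hP⟩ := SorensenPatching.exists_conj_of_trace_eq τ (W.framedTateGaloisRep 5) hssτ hssW htr'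
  exact ⟨P, ContinuousMonoidHom.ext fun σ => by rw [FramedRep.conj_apply]; exact (hP σ).symm⟩

/-- (PROVED) **The debt chain**: B1 + X‴ close X′ (B1 is PROVED in the companion
`STUB_IDEAS_stub_liftFive_2g10_B1.lean`, `irredFramedTateFive_holds`). -/
theorem debt_of_frobTrace (hB : IrredFramedTateFive) (h : MLTFrobTraceFive) : MLTTateSemistableFive' :=
  mltTateSemistableFive'_of_trace hB (mltTraceFive_of_frobTrace h)

/-! ### Sanity: X′ ⇒ X″ ⇒ X‴ (the new debts are WEAKENINGS) -/

/-- (PROVED) X′ ⇒ X″: conjugate matrices have equal traces. -/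
theorem trace_of_debt (h : MLTTateSemistableFive') : MLTTraceFive := by
  intro W _ ρ hρ habs h25 ρ₀ S hmem hcong hdet hSfin h5S hS
  have hf : Continuous (padicAlgClIntegers 5).subtype := continuous_subtype_val
  obtain ⟨ρ', hρ', P, hconj⟩ := h W ρ hρ habs h25 hf ρ₀ S hmem hcong hdet hSfin h5S hS
  refine ⟨ρ', hρ', fun σ => ?_⟩
  rw [← hconj]
  change (padicAlgClIntegers 5).subtype (FramedRep.trace ρ' σ) = _
  unfold FramedRep.trace
  rw [AddMonoidHom.map_trace, FramedRep.conj_apply, Units.val_mul, Units.val_mul,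
    Matrix.trace_units_conj, FramedRep.coe_baseChange_apply]

/-- (PROVED) X″ ⇒ X‴: take `S' = ∅`. -/
theorem frobTrace_of_trace (h : MLTTraceFive) : MLTFrobTraceFive := by
  intro W _ ρ hρ habs h25 ρ₀ S hmem hcong hdet hSfin h5S hS
  obtain ⟨ρ', hρ', htr⟩ := h W ρ hρ habs h25 ρ₀ S hmem hcong hdet hSfin h5S hS
  exact ⟨ρ', hρ', ∅, Set.finite_empty, fun _ _ _ _ σ _ => htr σ⟩

/-- (PROVED) X′ ⇒ X‴. -/
theorem frobTrace_of_debt (h : MLTTateSemistableFive') : MLTFrobTraceFive :=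
  frobTrace_of_trace (trace_of_debt h)

end Summit.ABC.ABC.Cruxes.FreyModularity.StubIdeas.LiftFive2g10

end
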